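import Literature.MathematicalPhysics.QuantumFieldTheory.Balaban1983to89.B7Eq84ConcreteRec
import Literature.MathematicalPhysics.QuantumFieldTheory.Balaban1983to89.B7Eq106Concrete

/-!
# `Balaban1983to89.B7Eq106ConcreteRec` — [Balaban1985Averaging] Sect. D (91), (101)–(108) pp. 31–33 (and Sect. B (62) p. 28) FOR THE RECORD's AVERAGING STRUCTURE ([Balaban1987RG1] (0.3)–(0.4)):
# PART 1 — the composition of averagings (91) (`j + i` levels = `i` levels of the level-`j` problem) and the level symbols above a site (unfoldings, shifts, expanded products) for the
# record twins; exact identities, proofs re-run from the engine's `B7Eq106Concrete` §3–§4 (the formulas (101)–(108) follow in `B7Eq108ConcreteRec`)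

statement-level skeleton of published theorems with citation tags; proofs where landed; nothing here is a claim about the Yang–Mills mass gap

CITATION HEADER (lean-in-tree rule).  Cell `pub-ymgap`, seat `pub-ymgap-dag-n05-e` g35 (N05-REC LEAD PEN); item R1 ([3] layer) of the road — the Sect. D FORMULAS (101)–(108) that [Balaban1987RG1] Sect. A
(1.18)–(1.31) manipulates (the cell's R2∕R4, n05-d: `B8Eq115GaugeFixingRec`, `B8Eq131DerivationRec`).  `--kind proof --supports stmt-QuantumFields-20541` (K0⁷; count-neutral; no definition).
Sources READ: [3] pp. 28–33 (`paper:balaban1985-cmp98-averaging`) through the engine module `B7Eq106Concrete`, whose §3–§6 proofs are re-run token for token over the record objects (TOKEN RULE: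
`bavg ↦ bavgZ`, `avgIter ↦ avgIterZ`, block points `y + boxVec L r ↦ y + offZ L r`, `fl ∕ brem ↦ flZ ∕ bremZ` (centred blocks), the Sect. C–D objects and level symbols ↦ their `…Z` twins of
`B7SectCDGaugeAveragesRec`; (77)∕(84)∕(88) from `B7Eq84ConcreteRec`, (99) from `B7Eq99ConcreteRec`, (92)∕(97) from `B7Eq92ConcreteRec`).  Descending products `dprod`, `mgauge_mgauge`, `uLev_add∕_mul`
and the group algebra are REUSED BY NAME from the engine.  The flat-background reductions (`lvDbT_one_left`, `eq106_one_left`, first instances) are NOT twinned here (LOCATED-N2 layer).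
WHAT IS PROVED (sorry-free): §3 `iterate_flZ_shift`, ★`avgIterZ_add` ((91)∕(43): `Ū^{j+i} = \overline{(Ū^j)}^i`), `dbavgCovIterZ_add`, `tildIterZ_add`, `vcovZ_add`, `uavgZ_add`, `axialGaugeZ_shift`; §4 `telHolZ_succ'`,
`telTwZ_succ'`, `telUpZ_zero`, `telUp_zero_left`, `telProdZ_succ`, `telTwZ_eq_telProdZ`, `lvHolZ_shift`, `lvTwZ_shift`, `lvDbTZ_shift`, `lvFrZ_shift`, `telUpZ_succ`, `telUpZ_succ_right`, `telHolZ_split`,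
`telProdZ_eq_dprod`, `Rc_inv_telProdZ_eq_dprod`.  The formulas (101)–(108) themselves follow in `B7Eq108ConcreteRec`.
HONEST SCOPE.  Exact algebraic identities for OUR typed record objects; no estimate; `HThm4Rec` UNDISCHARGED; N05 ∕ N07 NOT discharged; counts unmoved (typed 28∕28 · discharged 7∕28);
one finite 𝕋⁴ programme at fixed ε — nothing continuum ∕ ℝ⁴ ∕ OS ∕ mass gap ∕ Clay.  No `def`, no `instance`, no `notation`, no `sorry`.
-/

set_option autoImplicit false

noncomputable section

open scoped BigOperators
open NormedSpace Finset

namespace Literature.MathematicalPhysics.QuantumFieldTheory.Balaban1983to89.B7Eq106ConcreteRec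

open B7Prop1Explicit hiding Site
open B7Prop1Explicit renaming Site → SiteZ
open B7Prop2Explicit (rescale rescale_apply)
open MatrixLog B7AvgGaugeCovariance
open B7Eq92Concrete (Rc Rc_apply Rc_mul Rc_inv_apply Rc_one_apply mgauge mgauge_apply mgauge_mul tHol tHol_nil tHol_append_true tHol_append_false tHol_mgauge mlog_Rc expUnit_conj
  frame_eq_mgauge)
open B7Eq99Concrete (R0fun R0fun_apply R0fun_self R0fun_one_left R0fun_add inv_mul_const_mul tHol_mgauge_mul_R0fun)
open B7Eq84Concrete (R0fun_mul eq72_iff_eq76 Rc_injective)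
open B7Eq106Concrete (dprod dprod_zero dprod_succ dprod_one' dprod_congr map_dprod mgauge_mgauge uLev_add uLev_mul)
open BlockAveragingZd (offZ bavgZ avgIterZ avgIterZ_zero avgIterZ_succ)
open BlockAveragingZdCovariance (bavgZ_gaugeAct_units avgIterZ_gaugeAct_units)
open B7SectCDGaugeAveragesRec (flZ bremZ bctrZ offZ_bctrZ flZ_decomp flZ_block bremZ_block FcovZ wframeZ tildZ dbavgCovZ tildIterZ dbavgCovIterZ vcovZ SexpZ savgZ R0avgZ
  wrecZ wrecZ_zero tildIterZ_apply uavgZ uavgZ_zero uavgZ_succ AxialGaugeZ glevZ telHolZ telTwZ telHolZ_zero telTwZ_zero lvHolZ lvTwZ lvDbTZ lvFrZ telUpZ telProdZ telProdZ_zero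
  dbavgCovIterZ_zero dbavgCovIterZ_succ vcovZ_zero vcovZ_succ)
open B7Eq92ConcreteRec (tildZ_apply dbavgCovZ_apply tildIter_zero' tildIterZ_succ tildIterZ_mul dbavgCovIterZ_succ_apply vcovZ_succ_apply)
open B7Eq99ConcreteRec (SexpZ_apply savgZ_apply val_savgZ savgZ_const_mul savgZ_of_center_eq_one savgZ_tHol val_R0avgZ R0avgZ_of_60 wrecZ_succ wrecZ_one wrecZ_eq_vcovZ
  step100Z eq92Z tildIterZ_eq_mgauge_wrecZ eq88_of_87Z avgIterZ_eq_of_87)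
open B7Eq84ConcreteRec (SexpZ_congr savgZ_congr uavgZ_one eq76_of_axialGaugeZ eq84Z eq84Z_top eq81_iff_eq87Z eq88Z avgIterZ_eq_of_gauge bremZ_centre flZ_smul glevZ_of_lt glevZ_top
  glevZ_centre uLev_glevZ glevZ_block axialGaugeZ_glevZ eq81_glevZ gaugeFixingZ_exists gaugeFixingZ_unique eq88_glevZ avgIterZ_glevZ telHolZ_succ telTwZ_succ telRotZ_succ eq77Z
  gauge_formulaZ glevZ_formula)

variable {d : ℕ}

section Levels

/-- Block centres compose: `(flZ L)^[i] ((flZ L)^[j] x) = (flZ L)^[j+i] x`. [cite: Balaban1985Averaging, (91) p.31] -/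
theorem iterate_flZ_shift {d : ℕ} (L : ℕ) (j i : ℕ) (x : SiteZ d) : (flZ L)^[i] ((flZ L)^[j] x) = (flZ L)^[j + i] x := by
  rw [← Function.iterate_add_apply, Nat.add_comm]

end Levels

/-! ## §3 "A composition of averaging operations" (91): the objects at level `j + i` are those of the level-`j` problem at level `i` -/

section Semigroup

variable {𝔸 : Type*} [NormedRing 𝔸] [NormedAlgebra ℂ 𝔸] [CompleteSpace 𝔸]

/-- **(43) composed**: `\overline{(Ū^j)}^{i} = Ū^{j+i}` — `i` more averaging operations (42)/(43) applied to the `j`-fold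
average give the `(j+i)`-fold average (p. 24: "a sequence of averaging operations applied to a configuration U").
[cite: Balaban1985Averaging, (43) p.24] -/
theorem avgIterZ_add (L : ℕ) (V : SiteZ d → Fin d → 𝔸ˣ) (j : ℕ) :
    ∀ i : ℕ, avgIterZ L (avgIterZ L V j) i = avgIterZ L V (j + i)
  | 0 => rfl
  | i + 1 => by
    rw [avgIterZ_succ L (avgIterZ L V j) i, avgIterZ_add L V j i]
    rfl

/-- **(91) composed** (p. 31: "U̿₁^{j+1} = \overline{\overline{R(Ū₀^j)U̿₁^j}}, i.e., it is a composition of the operation (89) for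
V₀ = Ū₀^j and of the j-th order operation U̿₁^j"): the `(j+i)`-th double-bar average of `U₁` at the background `U₀` is the
`i`-th double-bar average of `U̿₁^j` at the background `Ū₀^j`. [cite: Balaban1985Averaging, (91) p.31] -/
theorem dbavgCovIterZ_add (L : ℕ) (U₀ U₁ : SiteZ d → Fin d → 𝔸ˣ) (j : ℕ) :
    ∀ i : ℕ, dbavgCovIterZ L (avgIterZ L U₀ j) (dbavgCovIterZ L U₀ U₁ j) i = dbavgCovIterZ L U₀ U₁ (j + i)
  | 0 => rfl
  | i + 1 => by
    funext z κ
    rw [B7Eq92ConcreteRec.dbavgCovIterZ_succ_apply L (avgIterZ L U₀ j) (dbavgCovIterZ L U₀ U₁ j) i z κ, dbavgCovIterZ_add L U₀ U₁ j i,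
      avgIterZ_add]
    rfl

/-- **(68)/(69) composed**: `Ũ₁^{j+i}` (relative to `U₀`) is the `i`-th object (69) of `Ũ₁^j` relative to the background `Ū₀^j`
(`(\overline{U₁U₀})^{j+i} = \overline{(Ũ₁^jŪ₀^j)}^{i}` by (43) composed). [cite: Balaban1985Averaging, (68)–(69) p.29, (43) p.24] -/
theorem tildIterZ_add (L : ℕ) (U₀ U₁ : SiteZ d → Fin d → 𝔸ˣ) (j i : ℕ) :
    tildIterZ L (avgIterZ L U₀ j) (tildIterZ L U₀ U₁ j) i = tildIterZ L U₀ U₁ (j + i) := by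
  funext z κ
  rw [tildIterZ_apply, tildIterZ_apply, tildIterZ_mul, avgIterZ_add, avgIterZ_add]

/-- **(97) composed**: the accumulated frame splits as `v_{j+i}(z) = v_j(L^iz)·v′_i(z)`, where `v′_i` is the accumulated frame (97)
of the level-`j` problem `(Ū₀^j, U̿₁^j)` — print's product (97)/(160) `v_{j+i} = w_0w_1⋯w_{j−1}·w_j⋯w_{j+i−1}` cut after `j`
factors, the later factors `\overline{R̄^{j+l}_{0,·}U̿₁^{j+l}}` being those of the level-`j` problem by (91) composed.
[cite: Balaban1985Averaging, (97) p.32, (160) p.42, (91) p.31] -/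
theorem vcovZ_add (L : ℕ) (U₀ U₁ : SiteZ d → Fin d → 𝔸ˣ) (j : ℕ) :
    ∀ (i : ℕ) (z : SiteZ d), vcovZ L U₀ U₁ (j + i) z
      = uLev L (vcovZ L U₀ U₁ j) i z * vcovZ L (avgIterZ L U₀ j) (dbavgCovIterZ L U₀ U₁ j) i z
  | 0, z => by simp
  | i + 1, z => by
    show vcovZ L U₀ U₁ (j + i + 1) z = _
    rw [B7SectCDGaugeAveragesRec.vcovZ_succ L U₀ U₁ (j + i) z, vcovZ_add L U₀ U₁ j i ((L : ℤ) • z), uLev_smul,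
      B7SectCDGaugeAveragesRec.vcovZ_succ L (avgIterZ L U₀ j) (dbavgCovIterZ L U₀ U₁ j) i z, avgIterZ_add, dbavgCovIterZ_add, mul_assoc]

/-- **(80) composed**: `\overline{R₀u}^{j+i}` is the `i`-th order average (79)/(80), at the background `Ū₀^j`, of the `j`-th
order average `\overline{R₀u}^j` ((80) is this for `i = 1`). [cite: Balaban1985Averaging, (80) p.30] -/
theorem uavgZ_add (L : ℕ) (U₀ : SiteZ d → Fin d → 𝔸ˣ) (u : SiteZ d → 𝔸ˣ) (j : ℕ) :
    ∀ i : ℕ, uavgZ L (avgIterZ L U₀ j) (uavgZ L U₀ u j) i = uavgZ L U₀ u (j + i)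
  | 0 => rfl
  | i + 1 => by
    funext z
    rw [uavgZ_succ L (avgIterZ L U₀ j) (uavgZ L U₀ u j) i z, uavgZ_add L U₀ u j i, avgIterZ_add]
    rfl

/-- **The gauge conditions descend to the level-`j` problem.** If `U′ = U₁^u` satisfies the block axial gauge conditions
(67) at the levels `< k` (relative to `U₀`), then for `j ≤ k` the level-`j` data — background `Ū₀^j`, field `U̿₁^j`, gauge
transformation `\overline{R₀u}^j` — satisfy (67) at the levels `< k − j`: indeed `(U̿₁^j)^{\overline{R₀u}^j} = (U̿₁^j)^{u_jv_j} =
((U̿₁^j)^{v_j})^{u_j} = (Ũ₁^j)^{u_j} = Ũ′^j` by (84)+(99) (`\overline{R₀u}^j = u_jv_j`), (55) an action, the fundamental equality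
(97) and the covariance (71), and the `i`-fold objects (69) of `Ũ′^j` at `Ū₀^j` are those of `U′` at level `j + i`.
[cite: Balaban1985Averaging, (67) p.29, (84) p.30, (97) p.32, (71) p.29] -/
theorem axialGaugeZ_shift (L : ℕ) (U₀ U₁ : SiteZ d → Fin d → 𝔸ˣ) (u : SiteZ d → 𝔸ˣ) {k j : ℕ}
    (hax : AxialGaugeZ L U₀ U₁ u k) (hj : j ≤ k) :
    AxialGaugeZ L (avgIterZ L U₀ j) (dbavgCovIterZ L U₀ U₁ j) (uavgZ L U₀ u j) (k - j) := by
  intro i hi z r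
  have h := hax (j + i) (by omega) z r
  rw [B7Eq92ConcreteRec.tildIterZ_mgauge, ← tildIterZ_add L U₀ U₁ j i, B7Eq92ConcreteRec.tildIterZ_eq_mgauge L U₀ U₁ j, B7Eq92ConcreteRec.tildIterZ_mgauge, avgIterZ_add,
    mgauge_mgauge, ← uLev_add L u j i, ← uLev_mul] at h
  have e : uavgZ L U₀ u j = fun z => uLev L u j z * vcovZ L U₀ U₁ j z := by
    rw [eq84Z L U₀ U₁ u hax j hj, wrecZ_eq_vcovZ]
  rw [e, B7Eq92ConcreteRec.tildIterZ_mgauge, avgIterZ_add]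
  exact h

end Semigroup

/-! ## §4 The level symbols of (101)–(108) above a site: unfoldings, recursions, shifts, expanded products -/

section LevelSymbols

variable {𝔸 : Type*} [NormedRing 𝔸] [NormedAlgebra ℂ 𝔸] [CompleteSpace 𝔸]

/-! ### Unfoldings and recursions -/

/-- `telHolZ_succ'`: `U₀(Γ^{(m+1)}_{x_{m+1},x}) = Ū₀^m(Γ_{x_{m+1},x_m})·U₀(Γ^{(m)}_{x_m,x})`.
[cite: Balaban1985Averaging, p.29 (display before (77))] -/
theorem telHolZ_succ' (L : ℕ) (hL : 1 ≤ L) (U₀ : SiteZ d → Fin d → 𝔸ˣ) (m : ℕ) (x : SiteZ d) :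
    telHolZ L hL U₀ (m + 1) x = lvHolZ L hL U₀ m x * telHolZ L hL U₀ m x := rfl

/-- `telTwZ_succ'`: the recursion of (77) in the level symbols, `T_{m+1} = (R̄^m_{0,x_{m+1}}Ũ₁^m)(Γ_{x_{m+1},x_m})·R(Ū₀^m(Γ_{x_{m+1},x_m}))[T_m]`.
[cite: Balaban1985Averaging, (77) p.30] -/
theorem telTwZ_succ' (L : ℕ) (hL : 1 ≤ L) (U₀ U₁ : SiteZ d → Fin d → 𝔸ˣ) (m : ℕ) (x : SiteZ d) :
    telTwZ L hL U₀ U₁ (m + 1) x = lvTwZ L hL U₀ U₁ m x * Rc (lvHolZ L hL U₀ m x) (telTwZ L hL U₀ U₁ m x) := rfl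

/-- `telProdZ_succ`. [cite: Balaban1985Averaging, (101) p.33] -/
theorem telProdZ_succ (L : ℕ) (hL : 1 ≤ L) (U₀ : SiteZ d → Fin d → 𝔸ˣ) (x : SiteZ d) (t : ℕ → 𝔸ˣ) (m : ℕ) :
    telProdZ L hL U₀ x t (m + 1) = t m * Rc (lvHolZ L hL U₀ m x) (telProdZ L hL U₀ x t m) := rfl

/-- The symbol `(R_{0,x_m}U₁)(Γ^{(m)}_{x_m,x})` of (77)/(101) is `telProdZ` for the factors `(R̄^j_{0,x_{j+1}}Ũ₁^j)(Γ_{x_{j+1},x_j})`.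
[cite: Balaban1985Averaging, (77) p.30, (101) p.33] -/
theorem telTwZ_eq_telProdZ (L : ℕ) (hL : 1 ≤ L) (U₀ U₁ : SiteZ d → Fin d → 𝔸ˣ) (x : SiteZ d) :
    ∀ m : ℕ, telTwZ L hL U₀ U₁ m x = telProdZ L hL U₀ x (fun j => lvTwZ L hL U₀ U₁ j x) m
  | 0 => rfl
  | m + 1 => by rw [telTwZ_succ', telProdZ_succ, telTwZ_eq_telProdZ L hL U₀ U₁ x m]

/-- `telUpZ_zero`: `Ū₀^i(Γ^{(0)}_{x_i,x_i}) = 1`. [cite: Balaban1985Averaging, p.29 (display before (77))] -/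
@[simp] theorem telUpZ_zero (L : ℕ) (hL : 1 ≤ L) (U₀ : SiteZ d → Fin d → 𝔸ˣ) (i : ℕ) (x : SiteZ d) :
    telUpZ L hL U₀ i 0 x = 1 := rfl

/-- `telUp_zero_left`: starting at level `0` it is `U₀(Γ^{(n)}_{x_n,x})` itself. [cite: Balaban1985Averaging, p.29 (display before (77))] -/
@[simp] theorem telUp_zero_left (L : ℕ) (hL : 1 ≤ L) (U₀ : SiteZ d → Fin d → 𝔸ˣ) (n : ℕ) (x : SiteZ d) :
    telUpZ L hL U₀ 0 n x = telHolZ L hL U₀ n x := rfl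

/-! ### The level symbols of the level-`j` problem are those of the original problem, `j` levels up -/

/-- `Ū₀^j`'s level-`i` block transporter above `x_j` is `Ū₀^{j+i}(Γ_{x_{j+i+1},x_{j+i}})`. [cite: Balaban1985Averaging, (43) p.24, p.29] -/
theorem lvHolZ_shift (L : ℕ) (hL : 1 ≤ L) (U₀ : SiteZ d → Fin d → 𝔸ˣ) (j i : ℕ) (x : SiteZ d) :
    lvHolZ L hL (avgIterZ L U₀ j) i ((flZ L)^[j] x) = lvHolZ L hL U₀ (j + i) x := by
  simp only [lvHolZ, avgIterZ_add, iterate_flZ_shift]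

/-- The level-`i` factor of (101) for the level-`j` problem `(Ū₀^j, Ũ₁^j)` is the level-`(j+i)` factor of the original.
[cite: Balaban1985Averaging, (68)–(69) p.29, (101) p.33] -/
theorem lvTwZ_shift (L : ℕ) (hL : 1 ≤ L) (U₀ U₁ : SiteZ d → Fin d → 𝔸ˣ) (j i : ℕ) (x : SiteZ d) :
    lvTwZ L hL (avgIterZ L U₀ j) (tildIterZ L U₀ U₁ j) i ((flZ L)^[j] x) = lvTwZ L hL U₀ U₁ (j + i) x := by
  simp only [lvTwZ, avgIterZ_add, tildIterZ_add, iterate_flZ_shift]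

/-- The level-`i` factor `(R̄′^i_{0}U̿′^i)(Γ)` of the level-`j` problem `(Ū₀^j, U̿₁^j)` is `(R̄^{j+i}_{0,x_{j+i+1}}U̿₁^{j+i})(Γ_{x_{j+i+1},x_{j+i}})`,
by (91) composed. [cite: Balaban1985Averaging, (91) p.31, (107) p.33] -/
theorem lvDbTZ_shift (L : ℕ) (hL : 1 ≤ L) (U₀ U₁ : SiteZ d → Fin d → 𝔸ˣ) (j i : ℕ) (x : SiteZ d) :
    lvDbTZ L hL (avgIterZ L U₀ j) (dbavgCovIterZ L U₀ U₁ j) i ((flZ L)^[j] x) = lvDbTZ L hL U₀ U₁ (j + i) x := by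
  simp only [lvDbTZ, avgIterZ_add, dbavgCovIterZ_add, iterate_flZ_shift]

/-- The level-`i` frame (105) of the level-`j` problem is `(\overline{R̄^{j+i}_{0,x_{j+i+1}}U̿₁^{j+i}})`, by (91) composed.
[cite: Balaban1985Averaging, (91) p.31, (105) p.33, (107) p.33] -/
theorem lvFrZ_shift (L : ℕ) (U₀ U₁ : SiteZ d → Fin d → 𝔸ˣ) (j i : ℕ) (x : SiteZ d) :
    lvFrZ L (avgIterZ L U₀ j) (dbavgCovIterZ L U₀ U₁ j) i ((flZ L)^[j] x) = lvFrZ L U₀ U₁ (j + i) x := by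
  simp only [lvFrZ, avgIterZ_add, dbavgCovIterZ_add, iterate_flZ_shift]

/-- `telUpZ_succ`: `Ū₀^i(Γ^{(n+1)}_{x_{i+n+1},x_i}) = Ū₀^{i+n}(Γ_{x_{i+n+1},x_{i+n}})·Ū₀^i(Γ^{(n)}_{x_{i+n},x_i})` (one more level on
top). [cite: Balaban1985Averaging, p.29 (display before (77))] -/
theorem telUpZ_succ (L : ℕ) (hL : 1 ≤ L) (U₀ : SiteZ d → Fin d → 𝔸ˣ) (i n : ℕ) (x : SiteZ d) :
    telUpZ L hL U₀ i (n + 1) x = lvHolZ L hL U₀ (i + n) x * telUpZ L hL U₀ i n x := by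
  show telHolZ L hL (avgIterZ L U₀ i) (n + 1) ((flZ L)^[i] x) = _
  rw [telHolZ_succ', lvHolZ_shift]
  rfl

/-- `telUpZ_succ_right`: `Ū₀^i(Γ^{(n+1)}_{x_{i+n+1},x_i}) = Ū₀^{i+1}(Γ^{(n)}_{x_{i+n+1},x_{i+1}})·Ū₀^i(Γ_{x_{i+1},x_i})` (the lowest
level split off) — the identity "R(Ū₀^{j+1}(Γ^{(k−j−1)}_{y,x_{j+1}}))R(Ū₀^j(Γ_{x_{j+1},x_j})) = R(Ū₀^j(Γ^{(k−j)}_{y,x_j}))" used in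
(103). [cite: Balaban1985Averaging, (103) p.33, (57) p.27] -/
theorem telUpZ_succ_right (L : ℕ) (hL : 1 ≤ L) (U₀ : SiteZ d → Fin d → 𝔸ˣ) (i : ℕ) :
    ∀ (n : ℕ) (x : SiteZ d), telUpZ L hL U₀ i (n + 1) x = telUpZ L hL U₀ (i + 1) n x * lvHolZ L hL U₀ i x
  | 0, x => by rw [telUpZ_succ, telUpZ_zero, telUpZ_zero, Nat.add_zero, mul_one, one_mul]
  | n + 1, x => by
    have e : i + (n + 1) = i + 1 + n := by omega
    rw [telUpZ_succ L hL U₀ i (n + 1) x, telUpZ_succ_right L hL U₀ i n x, telUpZ_succ L hL U₀ (i + 1) n x,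
      ← mul_assoc, e]

/-- `telHolZ_split`: `U₀(Γ^{(i+n)}_{x_{i+n},x}) = Ū₀^i(Γ^{(n)}_{x_{i+n},x_i})·U₀(Γ^{(i)}_{x_i,x})` — the telescoped product cut at
level `i`; with (57) this is "R(U₀(Γ^{(k)}_{y,x}))⁻¹R(Ū₀^{j+1}(Γ^{(k−j−1)}_{y,x_{j+1}})) = R(U₀(Γ^{(j+1)}_{x_{j+1},x}))⁻¹", the passage
from (104) to (106). [cite: Balaban1985Averaging, (104) p.33, (106) p.33, (57) p.27] -/
theorem telHolZ_split (L : ℕ) (hL : 1 ≤ L) (U₀ : SiteZ d → Fin d → 𝔸ˣ) (i : ℕ) (x : SiteZ d) :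
    ∀ n : ℕ, telHolZ L hL U₀ (i + n) x = telUpZ L hL U₀ i n x * telHolZ L hL U₀ i x
  | 0 => by rw [telUpZ_zero, one_mul, Nat.add_zero]
  | n + 1 => by
    show telHolZ L hL U₀ (i + n + 1) x = _
    rw [telHolZ_succ', telHolZ_split L hL U₀ i x n, telUpZ_succ, mul_assoc]

/-! ### The products expanded: print's `∏_{j=m−1}^{0}` with the relative rotations -/

/-- **The product form of (77)/(101)/(104)**: `P_m = ∏_{j=m−1}^{0} R(Ū₀^{j+1}(Γ^{(m−j−1)}_{x_m,x_{j+1}})) t_j` — the recursion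
`P_{m+1} = t_m·R(Ū₀^m(Γ_{x_{m+1},x_m}))[P_m]` expanded by the multiplicativity of `R` ((56): `R(X)(YZ) = R(X)Y·R(X)Z`) and (57)
`R(X)R(Y) = R(XY)`. [cite: Balaban1985Averaging, (101) p.33, (104) p.33, (77) p.30, (56)–(57) p.27] -/
theorem telProdZ_eq_dprod (L : ℕ) (hL : 1 ≤ L) (U₀ : SiteZ d → Fin d → 𝔸ˣ) (x : SiteZ d) (t : ℕ → 𝔸ˣ) :
    ∀ m : ℕ, telProdZ L hL U₀ x t m = dprod (fun j => Rc (telUpZ L hL U₀ (j + 1) (m - j - 1) x) (t j)) m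
  | 0 => rfl
  | m + 1 => by
    rw [telProdZ_succ, telProdZ_eq_dprod L hL U₀ x t m, dprod_succ]
    congr 1
    · show t m = Rc (telUpZ L hL U₀ (m + 1) (m + 1 - m - 1) x) (t m)
      rw [Nat.add_sub_cancel_left, Nat.sub_self, telUpZ_zero, Rc_one_apply]
    · rw [map_dprod]
      refine dprod_congr _ _ m fun j hj => ?_
      have e1 : m + 1 - j - 1 = (m - j - 1) + 1 := by omega
      have e2 : j + 1 + (m - j - 1) = m := by omega
      rw [e1, telUpZ_succ, e2, Rc_mul, MonoidHom.comp_apply]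

/-- **Conjugating back by the full transporter turns the relative rotations into the absolute ones of (106)**:
`R(U₀(Γ^{(m)}_{x_m,x}))⁻¹ P_m = ∏_{j=m−1}^{0} R(U₀(Γ^{(j+1)}_{x_{j+1},x}))⁻¹ t_j` (by `telHolZ_split` and (57)).
[cite: Balaban1985Averaging, (106) p.33, (57) p.27] -/
theorem Rc_inv_telProdZ_eq_dprod (L : ℕ) (hL : 1 ≤ L) (U₀ : SiteZ d → Fin d → 𝔸ˣ) (x : SiteZ d) (t : ℕ → 𝔸ˣ) :
    ∀ m : ℕ, Rc (telHolZ L hL U₀ m x)⁻¹ (telProdZ L hL U₀ x t m)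
      = dprod (fun j => Rc (telHolZ L hL U₀ (j + 1) x)⁻¹ (t j)) m
  | 0 => by rw [telProdZ_zero, map_one, dprod_zero]
  | m + 1 => by
    rw [dprod_succ, telProdZ_succ, map_mul, ← Rc_inv_telProdZ_eq_dprod L hL U₀ x t m, telHolZ_succ', mul_inv_rev,
      Rc_mul, MonoidHom.comp_apply, MonoidHom.comp_apply, (Rc_inv_apply _ _).1]

end LevelSymbols

end Literature.MathematicalPhysics.QuantumFieldTheory.Balaban1983to89.B7Eq106ConcreteRec
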